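import Summits.ResolutionOfSingularities.ResolutionOfSingularities.Theorems.FrobeniusLadderFRationalResolutionFixedPointMonomialNhd
import HarnessLib

/-!
# Crux `FrobeniusLadder.FRationalResolution` (stmt-ResolutionOfSingularities-15317), line `redirect`,
# stub `stub_diagonalizableQuotientResolution` — near a fixed point, the degree-zero part of a
# coordinate ideal `(x_I)` is spanned by the degree-zero MONOMIALS it contains (step (d) of the
# Kato-(7.1)-at-fixed-points plan, memo MEMO-15317-leafhand2-g3 §6)

For the fixed-point chart `P → S₀`, `m ↦ x^m`, Kato's ideal at a nearby prime `𝔮'` is generated by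
the monomials `x^m` of degree `0` meeting `I' = {i : xᵢ ∈ 𝔔'}`; to compare `(S₀)_𝔮'/K_{I'}` with the
regular stratum `S_𝔔'/(x_{I'})` one needs `(x_I) S ∩ S₀ ⊆ K_I` (the reverse inclusion is clear). At
the fixed point this is `…GradedMonomials.mem_span_monomials_of_mem_span_range` (where `S_𝔔 = (S₀)_𝔮[x]`);
here it is proved UNIFORMLY on the invariant neighbourhood `D(g)` of step (c)
(`…FixedPointMonomialNhd`: `g • S ⊆ S₀[x]`):

* `decompose_mem_span_monomials_of_mem_adjoin` — homogeneous components of an element of `S₀[x]`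
  are `S₀`-combinations of monomials of the right degree (the `∈ adjoin` form of
  `…GradedMonomials.decompose_mem_span_monomials`);
* `mem_span_monomials_of_eq_sum` — if `r ∈ S₀` equals `Σ_{i∈I} xᵢ bᵢ` with `bᵢ ∈ S₀[x]`, then `r` is
  an `S₀`-combination of degree-`0` monomials lying in `(x_I)`;
* **`exists_gradeZero_forall_mul_mem_span_monomials_of_fixed`** — at a fixed prime: ONE degree-zero
  `g ∉ 𝔔` such that for EVERY `I ⊆ {1..n}` and every `r ∈ S₀ ∩ (x_I)S`, `g r` is an
  `S₀`-combination of degree-`0` monomials in `(x_I)` (i.e. `g · ((x_I)S ∩ S₀) ⊆ K_I`).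

Honest label: elementary brick (no stub closed). No definitions, no named facts, no sorry.
[folklore; cite: Kato1994, Def. (2.1)] [cite: SGA3, Exp. VIII §4–5]
-/

noncomputable section

-- single-problem summit: the doubled namespace component is forced
set_option linter.dupNamespace false

open DirectSum IsLocalRing
open Literature.AlgebraicGeometry.Resolution.DiagonalizableQuotient

namespace Summit.ResolutionOfSingularities.ResolutionOfSingularities.Theorems.FRationalResolution.FixedPointContraction

universe u w

variable {k : Type u} [Field k] {A : Type w} [DecidableEq A] [AddCommGroup A] {S : Type u}
  [CommRing S] [Algebra k S] (𝒮 : A → Submodule k S) [GradedAlgebra 𝒮]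
  {n : ℕ} (x : Fin n → S) (a : Fin n → A) (hx : ∀ i, x i ∈ 𝒮 (a i))

include hx in
/-- Homogeneous components of an element of `S₀[x₁,…,x_n]` (homogeneous `xᵢ`) are `S₀`-combinations
of the monomials of that degree. [folklore] -/
theorem decompose_mem_span_monomials_of_mem_adjoin {y : S}
    (hy : y ∈ Algebra.adjoin (𝒮 0) (Set.range x)) (c : A) :
    (decompose 𝒮 y c : S) ∈
      Submodule.span (𝒮 0) ((Submonoid.closure (Set.range x) : Set S) ∩ (𝒮 c : Set S)) := by
  classical
  have hmem : y ∈ Subalgebra.toSubmodule (Algebra.adjoin (𝒮 0) (Set.range x)) := hy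
  rw [Algebra.adjoin_eq_span] at hmem
  clear hy
  have hsub : Submonoid.closure (Set.range x) ≤ SetLike.homogeneousSubmonoid 𝒮 :=
    GradedMonomials.closure_range_le_homogeneousSubmonoid 𝒮 x a hx
  induction hmem using Submodule.span_induction generalizing c with
  | mem z hz =>
    obtain ⟨d, hzd⟩ : SetLike.IsHomogeneousElem 𝒮 z := hsub hz
    by_cases hdc : d = c
    · subst hdc
      rw [decompose_of_mem_same 𝒮 hzd]
      exact Submodule.subset_span ⟨hz, hzd⟩
    · rw [decompose_of_mem_ne 𝒮 hzd hdc]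
      exact Submodule.zero_mem _
  | zero =>
    rw [decompose_zero, DirectSum.zero_apply, ZeroMemClass.coe_zero]
    exact Submodule.zero_mem _
  | add z w _ _ hz hw =>
    rw [decompose_add, DirectSum.add_apply, Submodule.coe_add]
    exact Submodule.add_mem _ (hz c) (hw c)
  | smul r z _ hz =>
    rw [Algebra.smul_def, show algebraMap (𝒮 0) S r = (r : S) from rfl,
      coe_decompose_mul_of_left_mem_zero 𝒮 r.2, ← show algebraMap (𝒮 0) S r = (r : S) from rfl,
      ← Algebra.smul_def]
    exact Submodule.smul_mem _ r (hz c)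

include hx in
/-- **Degree-zero part of a coordinate ideal, monomially.** If `r ∈ S₀` and `r = Σ_{i ∈ I} xᵢ bᵢ`
with all `bᵢ ∈ S₀[x₁,…,x_n]`, then `r` is an `S₀`-combination of MONOMIALS of degree `0` lying in the
ideal `(xᵢ : i ∈ I)` (project to degree `0`: `r = Σ xᵢ (bᵢ)_{−aᵢ}`, and expand `(bᵢ)_{−aᵢ}` in
monomials). [folklore; cite: Kato1994, Def. (2.1)] -/
theorem mem_span_monomials_of_eq_sum (I : Finset (Fin n)) (b : Fin n → S)
    (hb : ∀ i ∈ I, b i ∈ Algebra.adjoin (𝒮 0) (Set.range x)) (r : S) (hr0 : r ∈ 𝒮 0)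
    (hr : r = ∑ i ∈ I, x i * b i) :
    r ∈ Submodule.span (𝒮 0) {μ : S | μ ∈ Submonoid.closure (Set.range x) ∧ μ ∈ 𝒮 0 ∧
      μ ∈ Ideal.span (x '' (↑I : Set (Fin n)))} := by
  classical
  -- project to degree `0`
  have hr' : r = ∑ i ∈ I, x i * (decompose 𝒮 (b i) (-a i) : S) := by
    have h0 : GradedRing.proj 𝒮 0 r = r := by
      rw [GradedRing.proj_apply]; exact decompose_of_mem_same 𝒮 hr0
    rw [← h0, hr, map_sum]
    refine Finset.sum_congr rfl fun i _ => ?_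
    rw [GradedRing.proj_apply]
    have h := coe_decompose_mul_add_of_left_mem 𝒮 (j := -a i) (b := b i) (hx i)
    rwa [add_neg_cancel] at h
  rw [hr']
  refine Submodule.sum_mem _ fun i hi => ?_
  have hbi := decompose_mem_span_monomials_of_mem_adjoin 𝒮 x a hx (hb i hi) (-a i)
  have hmap : x i * (decompose 𝒮 (b i) (-a i) : S) ∈
      Submodule.map (LinearMap.mulLeft (𝒮 0) (x i))
        (Submodule.span (𝒮 0) ((Submonoid.closure (Set.range x) : Set S) ∩ (𝒮 (-a i) : Set S))) :=
    Submodule.mem_map_of_mem hbi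
  rw [Submodule.map_span] at hmap
  refine Submodule.span_mono ?_ hmap
  rintro _ ⟨μ, ⟨hμcl, hμdeg⟩, rfl⟩
  rw [LinearMap.mulLeft_apply]
  refine ⟨Submonoid.mul_mem _ (Submonoid.subset_closure ⟨i, rfl⟩) hμcl, ?_, ?_⟩
  · have h := SetLike.mul_mem_graded (hx i) hμdeg
    rwa [add_neg_cancel] at h
  · exact Ideal.mul_mem_right μ _ (Ideal.subset_span ⟨i, hi, rfl⟩)

include hx in
/-- **Step (d), uniformly near a fixed point.** `S` Noetherian of finite type over a field, torsion
grading, `𝔔` a FIXED prime, `x₁,…,x_n ∈ 𝔔` homogeneous and generating `𝔪_{S_𝔔}`. Then there is a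
degree-zero `g ∉ 𝔔` such that for every `I ⊆ {1,…,n}` and every degree-zero `r ∈ (xᵢ : i ∈ I)S`,
`g r` is an `S₀`-combination of degree-`0` MONOMIALS in the `xᵢ` lying in `(xᵢ : i ∈ I)` — i.e.
`g · ((x_I)S ∩ S₀) ⊆ K_I`, the Kato ideal of the stratum. [folklore; cite: Kato1994, Def. (2.1)] -/
theorem exists_gradeZero_forall_mul_mem_span_monomials_of_fixed [IsNoetherianRing S]
    [Algebra.FiniteType k S] (hA : AddMonoid.IsTorsion A) (𝔔 : Ideal S) [𝔔.IsPrime]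
    (hfix : ∀ a : A, a ≠ 0 → ∀ s ∈ 𝒮 a, s ∈ 𝔔)
    (hspan : Ideal.span (algebraMap S (Localization.AtPrime 𝔔) '' Set.range x) =
      maximalIdeal (Localization.AtPrime 𝔔)) :
    ∃ g : 𝒮 0, (g : S) ∉ 𝔔 ∧ ∀ (I : Finset (Fin n)) (r : S), r ∈ 𝒮 0 →
      r ∈ Ideal.span (x '' (↑I : Set (Fin n))) →
      (g : S) * r ∈ Submodule.span (𝒮 0) {μ : S | μ ∈ Submonoid.closure (Set.range x) ∧ μ ∈ 𝒮 0 ∧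
        μ ∈ Ideal.span (x '' (↑I : Set (Fin n)))} := by
  classical
  set t : Finset S := Finset.univ.image x with ht
  have htcoe : (↑t : Set S) = Set.range x := by
    rw [ht, Finset.coe_image, Finset.coe_univ, Set.image_univ]
  have htspan : Ideal.span (algebraMap S (Localization.AtPrime 𝔔) '' (↑t : Set S)) =
      maximalIdeal (Localization.AtPrime 𝔔) := by rw [htcoe, hspan]
  obtain ⟨g, hg, hgen⟩ :=
    FixedPointMonomialNhd.exists_gradeZero_forall_mul_mem_adjoin_of_fixed 𝒮 hA 𝔔 hfix t htspan
  rw [htcoe] at hgen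
  refine ⟨g, hg, fun I r hr0 hrI => ?_⟩
  -- `r = Σ_{i ∈ I} cᵢ xᵢ`
  rw [Set.image_eq_range] at hrI
  obtain ⟨c, hc⟩ := Ideal.mem_span_range_iff_exists_fun.mp hrI
  let b : Fin n → S := fun i => if h : i ∈ I then (g : S) * c ⟨i, h⟩ else 0
  have hb : ∀ i ∈ I, b i ∈ Algebra.adjoin (𝒮 0) (Set.range x) := fun i hi => by
    simp only [b, dif_pos hi]
    exact hgen _
  have hsum : (g : S) * r = ∑ i ∈ I, x i * b i := by
    rw [← hc, Finset.mul_sum, ← Finset.sum_coe_sort I (fun i => x i * b i)]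
    refine Finset.sum_congr rfl fun i _ => ?_
    have hi : (i : Fin n) ∈ I := Finset.mem_coe.mp i.2
    simp only [b, dif_pos hi]
    ring
  exact mem_span_monomials_of_eq_sum 𝒮 x a hx I b hb ((g : S) * r)
    (SetLike.mul_mem_graded g.2 hr0 |> fun h => by rwa [zero_add] at h) hsum

end Summit.ResolutionOfSingularities.ResolutionOfSingularities.Theorems.FRationalResolution.FixedPointContraction

end
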